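import Summits.Ventures.Crystal3D.Bulk.HoleForm
import Literature.Geometry.DiscreteGeometry.TammesThirteen
import HarnessLib

/-!
# The Tammes bridge in half-angle-tangent form: `HalfTanWitness κ s` + Tammes-13 at chord `s` ⇒ `NoHole κ`

Venture `Crystal3D` (cell `pub-crystal3d`, phase 2; seat p3; the bridge is seat idea-2's, `phase2/idea2/TAMMES-BRIDGE.md`
§B–§F — Böröczky–Szabó's contraction idea with a certified NONLINEAR profile). This file proves the GEOMETRIC half of the
(G2″) route in one step, directly in half-angle-tangent coordinates (no polar angles, no `arctan`):

* `noHole_of_halfTanWitness : κ < 1 → 0 < s → HalfTanWitness κ s → (Tammes-13 at chord s) → NoHole κ`.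

THE MAP. Fix the pole `Q = -p`. A unit vector `x` with `a = ⟪x, Q⟫ > -1` has half-tangent abscissa
`w = √((1 - a)/(1 + a))` (`= tan(t/2)` for the polar angle `t`, never named) and equatorial part `r = x - a • Q`, with
`(1 + w²) a = 1 - w²`, `(1 + w²) ‖r‖ = 2 w`. Its image under the profile `F` is
`y = ((1 - W²)/(1 + W²)) • Q + ((2 W/(1 + W²))/‖r‖) • r`, `W = F w` (`y = Q` when `r = 0`, consistently since `F 0 = 0`).
For two points, with the SAME `c = ⟪r₁, r₂⟫/(‖r₁‖ ‖r₂‖) ∈ [-1, 1]`: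
`(1 + w₁²)(1 + w₂²) ⟪x₁, x₂⟫ = (1 - w₁²)(1 - w₂²) + 4 w₁ w₂ c` and `(1 + W₁²)(1 + W₂²) ⟪y₁, y₂⟫ = (1 - W₁²)(1 - W₂²) + 4 W₁ W₂ c`.
So `HalfTanPairBound F κ s` says exactly: shell directions `≥ 60°` apart and outside the cap `⟪·, p⟫ > κ` have images at chord
`≥ s`; `HalfTanPoleBound` says the images are at chord `≥ s` from `p`. Twelve such directions plus `p` give THIRTEEN unit
vectors pairwise at chord `≥ s > 0` — contradicting Tammes-13 at chord `s`.

Instances with the tree's named fact `musinTarasov2012_tammes_thirteen` (chord `0.957`; Musin–Tarasov 2012, computer-assisted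
in print, NOT proved in the tree) and seat typer-bulk's `HoleForm.lean`: `noHole_063_of_tammes13`, `gapTuple_252_of_tammes13 :
musinTarasov2012_tammes_thirteen → GapTuple 2.52` (Hales's twelve-neighbour gap `2h₀` WITHOUT `flyspeck_L12`),
`bulkCrystallization3D_of_tammes13_of_classification`. Together with `HalfTanWitness.lean` (`HalfTanWitness 0.63 0.957`, trust
`Lean.ofReduceBool`) this closes the (G2″) chain. HONEST FRAMING: elementary inner-product algebra; nothing new is vendored;
standard axioms in this file (the instances take `HalfTanWitness 0.63 0.957` resp. the Tammes fact as hypotheses where noted).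

IMPORT CONE (K5 harvest H3, owed item (4); ruling 2026-09-01 «rename-and-redirect, append-only stands»): the shapes
`HalfTanPairBound / HalfTanPoleBound / HalfTanWitness` are declared HERE (namespace `…Crystal3D.TammesShape`, verbatim copies of
`HalfTanCert.lean` §1) and `export`ed into `TammesBridge` as aliases, so this module — hence `SphereCodeCut`, `CapX2Cert`, the bulk
theorem's whole headline enclosure — no longer imports `HalfTanCert.lean` (whose `CertW.certAll_true`, one `native_decide`, serves no
headline theorem). `HalfTanCert.lean` is untouched (its copies serve `HalfTanSound → … → HalfTanWitness.lean`; same bodies, so the two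
sides are definitionally equal and `BulkOfTammes.lean` composes them unchanged). All theorems below are byte-identical to before.
-/

noncomputable section

open scoped InnerProductSpace
open Finset

/-! ### 0. The statement shapes (verbatim copies of `HalfTanCert.lean` §1; see IMPORT CONE above) -/
namespace Summit.Ventures.Crystal3D.TammesShape

/-- PAIR BOUND in half-angle-tangent form: admissible abscissae `w₁, w₂ ≥ 0` (`w² (1 - κ) ≤ 1 + κ`) at angle `≥ 60°`
(longitude cosine `c`) have images at chord `≥ s`. Verbatim copy of `HalfTanCert.lean`'s `TammesBridge.HalfTanPairBound`. [folklore] -/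
def HalfTanPairBound (F : ℝ → ℝ) (κ s : ℝ) : Prop :=
  ∀ w₁ w₂ c : ℝ, 0 ≤ w₁ → 0 ≤ w₂ → w₁ ^ 2 * (1 - κ) ≤ 1 + κ → w₂ ^ 2 * (1 - κ) ≤ 1 + κ → -1 ≤ c → c ≤ 1 →
    (1 - w₁ ^ 2) * (1 - w₂ ^ 2) + 4 * w₁ * w₂ * c ≤ (1 / 2) * ((1 + w₁ ^ 2) * (1 + w₂ ^ 2)) →
    (1 - F w₁ ^ 2) * (1 - F w₂ ^ 2) + 4 * F w₁ * F w₂ * c ≤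
      (1 - s ^ 2 / 2) * ((1 + F w₁ ^ 2) * (1 + F w₂ ^ 2))
/-- POLE BOUND in half-angle-tangent form: the image stays at chord `≥ s` from the pole, `W² (s²/2) ≤ 2 - s²/2`. Verbatim
copy of `HalfTanCert.lean`'s `TammesBridge.HalfTanPoleBound`. [folklore] -/
def HalfTanPoleBound (F : ℝ → ℝ) (κ s : ℝ) : Prop :=
  ∀ w : ℝ, 0 ≤ w → w ^ 2 * (1 - κ) ≤ 1 + κ → F w ^ 2 * (s ^ 2 / 2) ≤ 2 - s ^ 2 / 2
/-- A trig-free profile witness at level `(κ, s)`: some `F ≥ 0` with `F 0 = 0`, pole and pair bounds. Verbatim copy of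
`HalfTanCert.lean`'s `TammesBridge.HalfTanWitness`. [folklore] -/
def HalfTanWitness (κ s : ℝ) : Prop :=
  ∃ F : ℝ → ℝ, (∀ w, 0 ≤ F w) ∧ F 0 = 0 ∧ HalfTanPoleBound F κ s ∧ HalfTanPairBound F κ s
end Summit.Ventures.Crystal3D.TammesShape

namespace Summit.Ventures.Crystal3D.TammesBridge
export Summit.Ventures.Crystal3D.TammesShape (HalfTanPairBound HalfTanPoleBound HalfTanWitness)

open Literature.Geometry.DiscreteGeometry

/-! ### 1. The half-tangent map of one point -/

section OnePoint

variable (F : ℝ → ℝ) (Q : (EuclideanSpace ℝ (Fin 3)))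

/-- Half-tangent abscissa `w = √((1 - a)/(1 + a))`, `a = ⟪x, Q⟫`. [folklore] -/
def htW (x : (EuclideanSpace ℝ (Fin 3))) : ℝ := Real.sqrt ((1 - ⟪x, Q⟫_ℝ) / (1 + ⟪x, Q⟫_ℝ))

/-- Equatorial part `r = x - ⟪x, Q⟫ • Q`. [folklore] -/
def htR (x : (EuclideanSpace ℝ (Fin 3))) : (EuclideanSpace ℝ (Fin 3)) := x - ⟪x, Q⟫_ℝ • Q

/-- Image height `α = (1 - W²)/(1 + W²)`, `W = F w`. [folklore] -/
def htA (x : (EuclideanSpace ℝ (Fin 3))) : ℝ := (1 - F (htW Q x) ^ 2) / (1 + F (htW Q x) ^ 2)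

/-- Image radius `γ = 2 W/(1 + W²)`. [folklore] -/
def htG (x : (EuclideanSpace ℝ (Fin 3))) : ℝ := 2 * F (htW Q x) / (1 + F (htW Q x) ^ 2)

/-- Coefficient of the equatorial part in the image (`γ/‖r‖`, or `0` at the pole). [folklore] -/
def htB (x : (EuclideanSpace ℝ (Fin 3))) : ℝ := if ‖htR Q x‖ = 0 then 0 else htG F Q x / ‖htR Q x‖

/-- **The image** `y = α • Q + (γ/‖r‖) • r`. [folklore] -/
def htImg (x : (EuclideanSpace ℝ (Fin 3))) : (EuclideanSpace ℝ (Fin 3)) := htA F Q x • Q + htB F Q x • htR Q x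

variable {F Q}

/-- The equatorial part is orthogonal to the pole. [folklore] -/
theorem inner_htR_Q (hQ : ‖Q‖ = 1) (x : (EuclideanSpace ℝ (Fin 3))) : ⟪htR Q x, Q⟫_ℝ = 0 := by
  simp only [htR, inner_sub_left, real_inner_smul_left, real_inner_self_eq_norm_sq, hQ]
  ring

/-- `‖r‖² = 1 - a²`. [folklore] -/
theorem norm_htR_sq (hQ : ‖Q‖ = 1) {x : (EuclideanSpace ℝ (Fin 3))} (hx : ‖x‖ = 1) : ‖htR Q x‖ ^ 2 = 1 - ⟪x, Q⟫_ℝ ^ 2 := by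
  have h : ‖htR Q x‖ ^ 2 = ‖x‖ ^ 2 - 2 * ⟪x, ⟪x, Q⟫_ℝ • Q⟫_ℝ + ‖⟪x, Q⟫_ℝ • Q‖ ^ 2 := by
    rw [htR, norm_sub_sq_real]
  rw [h, real_inner_smul_right, norm_smul, Real.norm_eq_abs, hx, hQ, mul_one, sq_abs]
  ring

/-- `x = a • Q + r`. [folklore] -/
theorem eq_htA_add_htR (x : (EuclideanSpace ℝ (Fin 3))) : x = ⟪x, Q⟫_ℝ • Q + htR Q x := by
  simp only [htR, add_sub_cancel]

/-- `-1 < a ≤ 1` gives `0 ≤ w`, `w² = (1 - a)/(1 + a)`. [folklore] -/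
theorem htW_sq (hQ : ‖Q‖ = 1) {x : (EuclideanSpace ℝ (Fin 3))} (hx : ‖x‖ = 1) (ha : -1 < ⟪x, Q⟫_ℝ) :
    0 ≤ htW Q x ∧ htW Q x ^ 2 = (1 - ⟪x, Q⟫_ℝ) / (1 + ⟪x, Q⟫_ℝ) := by
  have ha1 : ⟪x, Q⟫_ℝ ≤ 1 := by
    have := real_inner_le_norm x Q
    rw [hx, hQ, one_mul] at this
    exact this
  refine ⟨Real.sqrt_nonneg _, ?_⟩
  rw [htW, Real.sq_sqrt]
  exact div_nonneg (by linarith) (by linarith)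

/-- The two per-point identities `(1 + w²) a = 1 - w²`, `(1 + w²) ‖r‖ = 2 w`. [folklore] -/
theorem htW_identities (hQ : ‖Q‖ = 1) {x : (EuclideanSpace ℝ (Fin 3))} (hx : ‖x‖ = 1) (ha : -1 < ⟪x, Q⟫_ℝ) :
    (1 + htW Q x ^ 2) * ⟪x, Q⟫_ℝ = 1 - htW Q x ^ 2 ∧ (1 + htW Q x ^ 2) * ‖htR Q x‖ = 2 * htW Q x := by
  obtain ⟨hw0, hw2⟩ := htW_sq hQ hx ha
  have h1a : 0 < 1 + ⟪x, Q⟫_ℝ := by linarith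
  constructor
  · rw [hw2]
    field_simp
    ring
  · -- ‖r‖ = w (1 + a): both nonnegative with equal squares
    have hr2 := norm_htR_sq hQ hx
    have hsq : ‖htR Q x‖ ^ 2 = (htW Q x * (1 + ⟪x, Q⟫_ℝ)) ^ 2 := by
      rw [hr2, mul_pow, hw2]
      field_simp
      ring
    have hr : ‖htR Q x‖ = htW Q x * (1 + ⟪x, Q⟫_ℝ) := by
      have h1 := Real.sqrt_sq (norm_nonneg (htR Q x))
      have h2 := Real.sqrt_sq (mul_nonneg hw0 h1a.le)
      rw [← h1, hsq, h2]
    rw [hr, hw2]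
    field_simp
    ring

/-- At the pole (`r = 0`) the abscissa vanishes. [folklore] -/
theorem htW_eq_zero_of_norm_htR (hQ : ‖Q‖ = 1) {x : (EuclideanSpace ℝ (Fin 3))} (hx : ‖x‖ = 1) (ha : -1 < ⟪x, Q⟫_ℝ) (h0 : ‖htR Q x‖ = 0) :
    htW Q x = 0 := by
  have hr2 := norm_htR_sq hQ hx
  rw [h0] at hr2
  have ha1 : ⟪x, Q⟫_ℝ = 1 := by nlinarith
  rw [htW, ha1]
  norm_num

/-- `β ‖r‖ = γ` (at the pole both vanish because `F 0 = 0`). [folklore] -/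
theorem htB_mul_norm (hQ : ‖Q‖ = 1) (hFz : F 0 = 0) {x : (EuclideanSpace ℝ (Fin 3))} (hx : ‖x‖ = 1) (ha : -1 < ⟪x, Q⟫_ℝ) :
    htB F Q x * ‖htR Q x‖ = htG F Q x := by
  unfold htB
  split_ifs with h0
  · rw [htG, htW_eq_zero_of_norm_htR hQ hx ha h0, hFz]
    ring
  · exact div_mul_cancel₀ _ h0

/-- `α² + γ² = 1`. [folklore] -/
theorem htA_sq_add_htG_sq (x : (EuclideanSpace ℝ (Fin 3))) : htA F Q x ^ 2 + htG F Q x ^ 2 = 1 := by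
  have h : 0 < 1 + F (htW Q x) ^ 2 := by positivity
  unfold htA htG
  field_simp
  ring

/-- `(1 + W²) α = 1 - W²`, `(1 + W²) γ = 2 W`. [folklore] -/
theorem htA_htG_identities (x : (EuclideanSpace ℝ (Fin 3))) :
    (1 + F (htW Q x) ^ 2) * htA F Q x = 1 - F (htW Q x) ^ 2 ∧ (1 + F (htW Q x) ^ 2) * htG F Q x = 2 * F (htW Q x) := by
  have h : (1 + F (htW Q x) ^ 2) ≠ 0 := by positivity
  unfold htA htG
  constructor
  · field_simp
  · field_simp

/-- Inner product of two vectors of the form `α • Q + β • r` with `r ⊥ Q`. [folklore] -/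
theorem inner_smul_add_smul (hQ : ‖Q‖ = 1) {r₁ r₂ : (EuclideanSpace ℝ (Fin 3))} (h1 : ⟪r₁, Q⟫_ℝ = 0) (h2 : ⟪r₂, Q⟫_ℝ = 0)
    (α₁ β₁ α₂ β₂ : ℝ) : ⟪α₁ • Q + β₁ • r₁, α₂ • Q + β₂ • r₂⟫_ℝ = α₁ * α₂ + β₁ * β₂ * ⟪r₁, r₂⟫_ℝ := by
  have h1' : ⟪Q, r₁⟫_ℝ = 0 := by rw [real_inner_comm]; exact h1
  have h2' : ⟪Q, r₂⟫_ℝ = 0 := by rw [real_inner_comm]; exact h2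
  simp only [inner_add_left, inner_add_right, real_inner_smul_left, real_inner_smul_right, real_inner_self_eq_norm_sq,
    hQ, h1, h2', one_pow]
  ring

/-- **The image is a unit vector.** [folklore] -/
theorem norm_htImg (hQ : ‖Q‖ = 1) (hFz : F 0 = 0) {x : (EuclideanSpace ℝ (Fin 3))} (hx : ‖x‖ = 1) (ha : -1 < ⟪x, Q⟫_ℝ) :
    ‖htImg F Q x‖ = 1 := by
  have h0 := inner_htR_Q hQ x
  have hsq : ‖htImg F Q x‖ ^ 2 = 1 := by
    rw [← real_inner_self_eq_norm_sq, htImg, inner_smul_add_smul hQ h0 h0, real_inner_self_eq_norm_sq,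
      ← htA_sq_add_htG_sq (F := F) (Q := Q) x, ← htB_mul_norm hQ hFz hx ha]
    ring
  have h := Real.sqrt_sq (norm_nonneg (htImg F Q x))
  rw [hsq, Real.sqrt_one] at h
  exact h.symm

/-- **Height of the image:** `⟪y, Q⟫ = α`. [folklore] -/
theorem inner_htImg_Q (hQ : ‖Q‖ = 1) (x : (EuclideanSpace ℝ (Fin 3))) : ⟪htImg F Q x, Q⟫_ℝ = htA F Q x := by
  rw [htImg, inner_add_left, real_inner_smul_left, real_inner_smul_left, real_inner_self_eq_norm_sq, hQ, inner_htR_Q hQ x]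
  ring

end OnePoint

/-! ### 2. Two points: the common longitude cosine -/

section TwoPoints

variable {F : ℝ → ℝ} {Q : (EuclideanSpace ℝ (Fin 3))}

/-- **The two multiplied identities with a common `c ∈ [-1, 1]`.** [folklore] -/
theorem exists_cos (hQ : ‖Q‖ = 1) (hFz : F 0 = 0) {x₁ x₂ : (EuclideanSpace ℝ (Fin 3))} (hx₁ : ‖x₁‖ = 1) (hx₂ : ‖x₂‖ = 1)
    (ha₁ : -1 < ⟪x₁, Q⟫_ℝ) (ha₂ : -1 < ⟪x₂, Q⟫_ℝ) :
    ∃ c : ℝ, -1 ≤ c ∧ c ≤ 1 ∧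
      (1 + htW Q x₁ ^ 2) * (1 + htW Q x₂ ^ 2) * ⟪x₁, x₂⟫_ℝ =
        (1 - htW Q x₁ ^ 2) * (1 - htW Q x₂ ^ 2) + 4 * htW Q x₁ * htW Q x₂ * c ∧
      (1 + F (htW Q x₁) ^ 2) * (1 + F (htW Q x₂) ^ 2) * ⟪htImg F Q x₁, htImg F Q x₂⟫_ℝ =
        (1 - F (htW Q x₁) ^ 2) * (1 - F (htW Q x₂) ^ 2) + 4 * F (htW Q x₁) * F (htW Q x₂) * c := by
  -- the common cosine `c` with `⟪r₁, r₂⟫ = ‖r₁‖ ‖r₂‖ c`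
  obtain ⟨c, hc1, hc2, hinner⟩ : ∃ c : ℝ, -1 ≤ c ∧ c ≤ 1 ∧
      ⟪htR Q x₁, htR Q x₂⟫_ℝ = ‖htR Q x₁‖ * ‖htR Q x₂‖ * c := by
    by_cases h : ‖htR Q x₁‖ * ‖htR Q x₂‖ = 0
    · refine ⟨0, by norm_num, by norm_num, ?_⟩
      rcases mul_eq_zero.1 h with h1 | h2
      · rw [norm_eq_zero] at h1
        rw [h1, inner_zero_left]
        simp
      · rw [norm_eq_zero] at h2
        rw [h2, inner_zero_right]
        simp
    · have hpos : 0 < ‖htR Q x₁‖ * ‖htR Q x₂‖ := lt_of_le_of_ne (by positivity) (Ne.symm h)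
      have habs := abs_real_inner_le_norm (htR Q x₁) (htR Q x₂)
      rw [abs_le] at habs
      refine ⟨⟪htR Q x₁, htR Q x₂⟫_ℝ / (‖htR Q x₁‖ * ‖htR Q x₂‖), ?_, ?_, ?_⟩
      · rw [le_div_iff₀ hpos]; linarith
      · rw [div_le_iff₀ hpos]; linarith
      · symm
        rw [mul_comm]
        exact div_mul_cancel₀ _ h
  refine ⟨c, hc1, hc2, ?_, ?_⟩
  · -- original pair
    obtain ⟨e1, e2⟩ := htW_identities hQ hx₁ ha₁
    obtain ⟨f1, f2⟩ := htW_identities hQ hx₂ ha₂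
    have hx12 : ⟪x₁, x₂⟫_ℝ = ⟪x₁, Q⟫_ℝ * ⟪x₂, Q⟫_ℝ + ‖htR Q x₁‖ * ‖htR Q x₂‖ * c := by
      have e := inner_smul_add_smul hQ (inner_htR_Q hQ x₁) (inner_htR_Q hQ x₂) ⟪x₁, Q⟫_ℝ 1 ⟪x₂, Q⟫_ℝ 1
      rw [one_smul, one_smul, ← eq_htA_add_htR (Q := Q) x₁, ← eq_htA_add_htR (Q := Q) x₂] at e
      rw [e, hinner]
      ring
    rw [hx12]
    calc (1 + htW Q x₁ ^ 2) * (1 + htW Q x₂ ^ 2) * (⟪x₁, Q⟫_ℝ * ⟪x₂, Q⟫_ℝ + ‖htR Q x₁‖ * ‖htR Q x₂‖ * c)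
        = ((1 + htW Q x₁ ^ 2) * ⟪x₁, Q⟫_ℝ) * ((1 + htW Q x₂ ^ 2) * ⟪x₂, Q⟫_ℝ) +
          ((1 + htW Q x₁ ^ 2) * ‖htR Q x₁‖) * ((1 + htW Q x₂ ^ 2) * ‖htR Q x₂‖) * c := by ring
      _ = (1 - htW Q x₁ ^ 2) * (1 - htW Q x₂ ^ 2) + 4 * htW Q x₁ * htW Q x₂ * c := by
          rw [e1, e2, f1, f2]; ring
  · -- images
    obtain ⟨e1, e2⟩ := htA_htG_identities (F := F) (Q := Q) x₁
    obtain ⟨f1, f2⟩ := htA_htG_identities (F := F) (Q := Q) x₂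
    have hb₁ := htB_mul_norm hQ hFz hx₁ ha₁
    have hb₂ := htB_mul_norm hQ hFz hx₂ ha₂
    have hy12 : ⟪htImg F Q x₁, htImg F Q x₂⟫_ℝ = htA F Q x₁ * htA F Q x₂ + htG F Q x₁ * htG F Q x₂ * c := by
      rw [htImg, htImg, inner_smul_add_smul hQ (inner_htR_Q hQ x₁) (inner_htR_Q hQ x₂), hinner, ← hb₁, ← hb₂]
      ring
    rw [hy12]
    calc (1 + F (htW Q x₁) ^ 2) * (1 + F (htW Q x₂) ^ 2) * (htA F Q x₁ * htA F Q x₂ + htG F Q x₁ * htG F Q x₂ * c)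
        = ((1 + F (htW Q x₁) ^ 2) * htA F Q x₁) * ((1 + F (htW Q x₂) ^ 2) * htA F Q x₂) +
          ((1 + F (htW Q x₁) ^ 2) * htG F Q x₁) * ((1 + F (htW Q x₂) ^ 2) * htG F Q x₂) * c := by ring
      _ = (1 - F (htW Q x₁) ^ 2) * (1 - F (htW Q x₂) ^ 2) + 4 * F (htW Q x₁) * F (htW Q x₂) * c := by
          rw [e1, e2, f1, f2]; ring

end TwoPoints

/-! ### 3. The bridge -/

/-- A chord bound from an inner-product bound: `⟪u, v⟫ ≤ 1 - s²/2` for unit vectors gives `dist u v ≥ s`. [folklore] -/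
theorem le_dist_of_inner_le {u v : (EuclideanSpace ℝ (Fin 3))} (hu : ‖u‖ = 1) (hv : ‖v‖ = 1) {s : ℝ} (hs : 0 < s)
    (h : ⟪u, v⟫_ℝ ≤ 1 - s ^ 2 / 2) : s ≤ dist u v := by
  rw [dist_eq_norm]
  have hsq : s ^ 2 ≤ ‖u - v‖ ^ 2 := by
    rw [norm_sub_sq_real, hu, hv]
    linarith
  by_contra hlt
  push Not at hlt
  nlinarith [norm_nonneg (u - v)]

/-- **The Tammes bridge, half-tangent form.** If `κ < 1`, `0 < s`, a trig-free profile witness exists at level `(κ, s)`, and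
thirteen unit vectors pairwise at chord `≥ s` cannot exist, then there is no hole of cosine level `κ` in a shell of twelve
`60°`-separated directions: `NoHole κ`. [folklore] -/
theorem noHole_of_halfTanWitness {κ s : ℝ} (hκ : κ < 1) (hs : 0 < s) (hW : HalfTanWitness κ s)
    (hT : ∀ T : Finset (EuclideanSpace ℝ (Fin 3)), (∀ v ∈ T, ‖v‖ = 1) → (∀ v ∈ T, ∀ w ∈ T, v ≠ w → s ≤ dist v w) → T.card ≤ 12) :
    NoHole κ := by
  obtain ⟨F, hF0, hFz, hpole, hpair⟩ := hW
  intro x p hx hp hsep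
  by_contra hno
  push Not at hno
  -- the pole and the heights
  set Q : (EuclideanSpace ℝ (Fin 3)) := -p with hQdef
  have hQ : ‖Q‖ = 1 := by rw [hQdef, norm_neg, hp]
  have haQ : ∀ i, ⟪x i, Q⟫_ℝ = -⟪p, x i⟫_ℝ := fun i => by rw [hQdef, inner_neg_right, real_inner_comm]
  have ha : ∀ i, -1 < ⟪x i, Q⟫_ℝ := fun i => by rw [haQ]; linarith [hno i]
  -- admissibility of the abscissae
  have hadm : ∀ i, htW Q (x i) ^ 2 * (1 - κ) ≤ 1 + κ := by
    intro i
    obtain ⟨-, hw2⟩ := htW_sq hQ (hx i) (ha i)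
    have h1a : 0 < 1 + ⟪x i, Q⟫_ℝ := by linarith [ha i]
    rw [hw2, div_mul_eq_mul_div, div_le_iff₀ h1a]
    nlinarith [hno i, haQ i]
  have hw0 : ∀ i, 0 ≤ htW Q (x i) := fun i => (htW_sq hQ (hx i) (ha i)).1
  -- the images
  set y : Fin 12 → (EuclideanSpace ℝ (Fin 3)) := fun i => htImg F Q (x i) with hydef
  have hy1 : ∀ i, ‖y i‖ = 1 := fun i => norm_htImg hQ hFz (hx i) (ha i)
  -- image–image chords
  have hyy : ∀ i j, i ≠ j → s ≤ dist (y i) (y j) := by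
    intro i j hij
    obtain ⟨c, hc1, hc2, hX, hY⟩ := exists_cos (F := F) hQ hFz (hx i) (hx j) (ha i) (ha j)
    have hprem : (1 - htW Q (x i) ^ 2) * (1 - htW Q (x j) ^ 2) + 4 * htW Q (x i) * htW Q (x j) * c ≤
        (1 / 2) * ((1 + htW Q (x i) ^ 2) * (1 + htW Q (x j) ^ 2)) := by
      rw [← hX]
      have hpos : 0 ≤ (1 + htW Q (x i) ^ 2) * (1 + htW Q (x j) ^ 2) := by positivity
      nlinarith [hsep i j hij]
    have hcon := hpair _ _ c (hw0 i) (hw0 j) (hadm i) (hadm j) hc1 hc2 hprem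
    rw [← hY] at hcon
    have hpos : 0 < (1 + F (htW Q (x i)) ^ 2) * (1 + F (htW Q (x j)) ^ 2) := by positivity
    have hinner : ⟪y i, y j⟫_ℝ ≤ 1 - s ^ 2 / 2 := by
      by_contra hlt
      push Not at hlt
      nlinarith [mul_lt_mul_of_pos_left hlt hpos]
    exact le_dist_of_inner_le (hy1 i) (hy1 j) hs hinner
  -- image–pole chords
  have hyp : ∀ i, s ≤ dist (y i) p := by
    intro i
    have hpb := hpole _ (hw0 i) (hadm i)
    have hAi : ⟪y i, Q⟫_ℝ = htA F Q (x i) := inner_htImg_Q hQ (x i)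
    have hinner : ⟪y i, p⟫_ℝ ≤ 1 - s ^ 2 / 2 := by
      have : ⟪y i, p⟫_ℝ = -htA F Q (x i) := by
        rw [← hAi, hQdef, inner_neg_right, neg_neg]
      rw [this, htA]
      have hpos : 0 < 1 + F (htW Q (x i)) ^ 2 := by positivity
      rw [neg_le, le_div_iff₀ hpos]
      nlinarith
    exact le_dist_of_inner_le (hy1 i) hp hs hinner
  -- the thirteen-point set
  have hinj : Function.Injective y := by
    intro i j hij
    by_contra hne
    have := hyy i j hne
    rw [hij, dist_self] at this
    linarith
  have hnot : p ∉ (univ : Finset (Fin 12)).image y := by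
    intro hmem
    obtain ⟨i, -, hi⟩ := Finset.mem_image.1 hmem
    have := hyp i
    rw [hi, dist_self] at this
    linarith
  have hcard : (insert p ((univ : Finset (Fin 12)).image y)).card = 13 := by
    rw [Finset.card_insert_of_notMem hnot, Finset.card_image_of_injective _ hinj, Finset.card_univ, Fintype.card_fin]
  have h12 := hT (insert p ((univ : Finset (Fin 12)).image y)) ?_ ?_
  · rw [hcard] at h12
    norm_num at h12
  · intro v hv
    rcases Finset.mem_insert.1 hv with rfl | hv
    · exact hp
    · obtain ⟨i, -, rfl⟩ := Finset.mem_image.1 hv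
      exact hy1 i
  · intro v hv w hw hvw
    rcases Finset.mem_insert.1 hv with rfl | hv
    · rcases Finset.mem_insert.1 hw with rfl | hw
      · exact absurd rfl hvw
      · obtain ⟨j, -, rfl⟩ := Finset.mem_image.1 hw
        rw [dist_comm]; exact hyp j
    · obtain ⟨i, -, rfl⟩ := Finset.mem_image.1 hv
      rcases Finset.mem_insert.1 hw with rfl | hw
      · exact hyp i
      · obtain ⟨j, -, rfl⟩ := Finset.mem_image.1 hw
        have hij : i ≠ j := fun h => hvw (by rw [h])
        exact hyy i j hij

/-! ### 4. Instances at `(κ, s) = (0.63, 0.957)` -/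

/-- **Tammes-13 (chord `0.957`) and a certified profile give the angular gap:** `NoHole 0.63`. [folklore] -/
theorem noHole_063_of_halfTanWitness (hW : HalfTanWitness 0.63 0.957) (hMT : musinTarasov2012_tammes_thirteen) :
    NoHole 0.63 :=
  noHole_of_halfTanWitness (by norm_num) (by norm_num) hW hMT

/-- **… hence Hales's twelve-neighbour gap `GapTuple 2.52`** (seat typer-bulk's `gapTuple_252_of_noHole`). [folklore] -/
theorem gapTuple_252_of_halfTanWitness (hW : HalfTanWitness 0.63 0.957) (hMT : musinTarasov2012_tammes_thirteen) :
    GapTuple 2.52 :=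
  gapTuple_252_of_noHole (noHole_063_of_halfTanWitness hW hMT)

/-- **… and bulk crystallization with `K = 1296`**, given the tree's kissing classification (a computational theorem of the
tree, `Hales2012_kissingConfigCongruent_holds`; taken as a hypothesis here to keep this file on standard axioms). [folklore] -/
theorem bulkCrystallization3D_of_halfTanWitness (hW : HalfTanWitness 0.63 0.957)
    (hMT : musinTarasov2012_tammes_thirteen) (hcl : Hales2012_kissingConfigCongruent) : BulkCrystallization3D 1296 :=
  bulkCrystallization3D_of_noHole_of_classification (noHole_063_of_halfTanWitness hW hMT) hcl

end Summit.Ventures.Crystal3D.TammesBridge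

end
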